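import Literature.Barriers.AnomalousDissipation.SingleShellEnstrophyBound
import Literature.Analysis.FluidPDE.LerayHopfRestartTorus
import Literature.Analysis.FluidPDE.LongTimeAverageShift
import Literature.Analysis.FluidPDE.AlexakisDoeringProofs
import Literature.Analysis.FluidPDE.AlexakisDoeringRegularity
import Literature.Analysis.FluidPDE.LongTimeAverageNonneg
import HarnessLib

/-!
# Tran–Shepherd's dynamical constraint in the long-time mean, all `L²` data
(barrier-audit proof file next to `Literature/Barriers/AnomalousDissipation/GravestModeLaminarAttractor`,
audit generation 6; sibling of `SingleShellEnstrophyBound`)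

`SingleShellEnstrophyBound` proves, for a steady smooth divergence-free mean-zero force on `𝕋²`
with Fourier support on ONE shell `|k|² = m`, `m > 0`, `λ = 4π²m`, and every global Leray–Hopf
solution `u` from an `L² ∩ H¹` datum, the integrated constraint `∫₀ᵀ‖∇u‖² ≤ λ∫₀ᵀ‖u‖² + C`
(Tran–Shepherd, Physica D 165 (2002), §4). This file passes to `limsup` long-time means and to
arbitrary data:

* `longTimeAvgSup_le_mul_of_setIntegral_le` — real-variable: `∫₀ᵀ Z ≤ c∫₀ᵀ E + C` for all
  `T`, `E` with bounded running means ⇒ `⟨Z⟩ ≤ c⟨E⟩`;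
* `singleShell_meanEnstrophy_le_of_H1`, `singleShell_meanEnstrophy_le` — `⟨‖∇u‖²⟩ ≤ λ⟨‖u‖²⟩`
  for `H¹` data, then for ALL `L²` data by restart at an `H¹` time
  (`IsGlobalLerayHopf.exists_isGlobalLerayHopf_translate`) and translation invariance of the
  means (`longTimeAvgSup_comp_add_right`, `IsGlobalLerayHopf.meanEnergy_translate`);
* `meanEnstrophy_nonpos_of_force_zero` — unforced: `⟨‖∇u‖²⟩ = 0`;
  `singleShell_meanEnstrophy_le_max` — all real levels `m` at once:
  `⟨‖∇u‖²⟩ ≤ 4π² max(m,0) ⟨‖u‖²⟩` (for `m ≤ 0` the force vanishes).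

This is the mean form `ε ≤ νk_f²U²` of Alexakis–Doering, Phys. Lett. A 359 (2006), §4, for
monoscale forcing, for Leray–Hopf solutions and honest `limsup` means.

## References

* C. V. Tran, T. G. Shepherd, Physica D 165 (2002) 199–212, §4. [`TranShepherd2002`]
* A. Alexakis, C. R. Doering, Phys. Lett. A 359 (2006) 652–657, §4. [`AlexakisDoering2006PLA`]
* C. Foias, O. Manley, R. Rosa, R. Temam, *Navier–Stokes Equations and Turbulence*, CUP 2001,
  Ch. II Thm. 7.3–7.4, (7.16)–(7.17). [`FoiasManleyRosaTemam2001`]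
-/

open MeasureTheory Set Filter Topology UnitAddTorus
open scoped ENNReal NNReal InnerProductSpace

noncomputable section

namespace Literature.Barriers.AnomalousDissipation

open Literature.Analysis.FunctionSpaces Literature.Analysis.FunctionSpaces.Torus
open Literature.Analysis.FluidPDE Literature.Analysis.FluidPDE.Torus

/-! ### A real-variable lemma: integrated comparison passes to `limsup` running means -/

section RealVariable

/-- **Integrated comparison passes to the `limsup` of running means.** If `Z ≥ 0`, `E ≥ 0`, the
running means `T⁻¹∫₀ᵀE` are eventually bounded above, and `∫₀ᵀ Z ≤ c∫₀ᵀ E + C` for every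
`T > 0` with `c ≥ 0`, then `limsup_T T⁻¹∫₀ᵀ Z ≤ c · limsup_T T⁻¹∫₀ᵀ E` (honest `limsup`s:
the comparison and the bound on `E` make the means of `Z` bounded as well). [folklore] -/
theorem longTimeAvgSup_le_mul_of_setIntegral_le {Z E : ℝ → ℝ} {c C : ℝ} (hc : 0 ≤ c)
    (hZ : ∀ t, 0 ≤ Z t) (hE : ∀ t, 0 ≤ E t)
    (hEb : IsBoundedUnder (· ≤ ·) atTop (timeMean E))
    (h : ∀ T, 0 < T → ∫ t in Ioc 0 T, Z t ≤ c * (∫ t in Ioc 0 T, E t) + C) :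
    longTimeAvgSup Z ≤ c * longTimeAvgSup E := by
  have hL0 : 0 ≤ longTimeAvgSup E := longTimeAvgSup_nonneg hE
  refine limsup_le_of_forall_pos_eventually_le (h := fun δ => c * (longTimeAvgSup E + δ) + δ) ?_ ?_ ?_
  · exact (eventually_ge_atTop 0).mono fun T hT => timeMean_nonneg hZ hT
  · intro δ hδ
    have hev : ∀ᶠ T in atTop, timeMean E T < longTimeAvgSup E + δ :=
      eventually_lt_of_limsup_lt (by show longTimeAvgSup E < _; linarith) hEb
    filter_upwards [hev, eventually_gt_atTop 0, eventually_ge_atTop (|C| / δ)] with T hTE hT0 hTC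
    rw [timeMean_eq_inv_mul_setIntegral _ hT0.le] at hTE ⊢
    have hCT : T⁻¹ * C ≤ δ := by
      rw [inv_mul_le_iff₀ hT0]
      have h1 : |C| ≤ T * δ := by rwa [div_le_iff₀ hδ] at hTC
      exact (le_abs_self C).trans h1
    calc T⁻¹ * ∫ t in Ioc 0 T, Z t ≤ T⁻¹ * (c * (∫ t in Ioc 0 T, E t) + C) :=
          mul_le_mul_of_nonneg_left (h T hT0) (inv_nonneg.2 hT0.le)
      _ = c * (T⁻¹ * ∫ t in Ioc 0 T, E t) + T⁻¹ * C := by ring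
      _ ≤ c * (longTimeAvgSup E + δ) + δ := add_le_add (mul_le_mul_of_nonneg_left hTE.le hc) hCT
  · have ht : Tendsto (fun δ : ℝ => c * (longTimeAvgSup E + δ) + δ) (𝓝 0)
        (𝓝 (c * (longTimeAvgSup E + 0) + 0)) :=
      ((tendsto_const_nhds.add tendsto_id).const_mul c).add tendsto_id
    rw [add_zero, add_zero] at ht
    exact ht.mono_left nhdsWithin_le_nhds

end RealVariable

/-! ### The mean dynamical constraint `⟨‖∇u‖²⟩ ≤ λ⟨‖u‖²⟩` -/

section Mean

variable {ν : ℝ} {g u₀ : UnitAddTorus (Fin 2) → EuclideanSpace ℝ (Fin 2)}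
  {u : ℝ → UnitAddTorus (Fin 2) → EuclideanSpace ℝ (Fin 2)}

/-- **Mean form, `L² ∩ H¹` data**: under the hypotheses of `singleShell_setIntegral_enstrophy_le`,
`⟨‖∇u‖₂²⟩ ≤ 4π²m · ⟨‖u‖₂²⟩` (`limsup` long-time means; the running means of the energy are
bounded, `IsGlobalLerayHopf.isBoundedUnder_timeMean_energy`) — Tran–Shepherd's constraint
`‖u‖₁² ≤ λ_s‖u‖²` in time mean, the transient having time mean zero. [cite: TranShepherd2002, §4 (constraint)] -/
theorem singleShell_meanEnstrophy_le_of_H1 (hν : 0 < ν) (hg : IsSmooth g) (hgd : IsDivFree g)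
    (hg0 : HasZeroMean g) {m : ℝ} (hm : 0 < m)
    (hshell : ∀ k : Fin 2 → ℤ, freqNormSq k ≠ m → mFourierCoeff (EuclideanSpace.complexify ∘ g) k = 0)
    (hu₀ : MemLp u₀ 2 volume) (hG : eGradNormSq u₀ ≠ ⊤) (hdiv : IsWeaklyDivFree u₀)
    (hu : IsGlobalLerayHopf ν (fun _ => g) u₀ u) :
    longTimeAvgSup (fun t => (eGradNormSq (u t)).toReal) ≤ 4 * Real.pi ^ 2 * m * meanEnergy u := by
  obtain ⟨C, hC⟩ := singleShell_setIntegral_enstrophy_le hν hg hgd hg0 hm hshell hu₀ hG hdiv hu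
  rw [meanEnergy_eq_longTimeAvgSup]
  exact longTimeAvgSup_le_mul_of_setIntegral_le (by positivity) (fun _ => ENNReal.toReal_nonneg)
    (fun _ => integral_nonneg fun _ => sq_nonneg _)
    (hu.isBoundedUnder_timeMean_energy hν (hg.memLp 2) hg0) hC

/-- **Tran–Shepherd's dynamical constraint in the mean, for ALL `L²` data** (Tran–Shepherd 2002,
§4, (constraint) `‖u‖₁² ≤ λ_s‖u‖²`: "a non-positive value will evolve but remain non-positive
for all time"; Alexakis–Doering 2006, §4: `ε ≤ νk_f²U²` for monoscale forcing). On `𝕋²`, for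
`ν > 0`, a smooth divergence-free mean-zero steady force with
Fourier support on ONE shell `|k|² = m`, `m > 0`, and EVERY global Leray–Hopf solution `u`
from an arbitrary datum (any momentum): `⟨‖∇u‖₂²⟩ ≤ 4π²m · ⟨‖u‖₂²⟩`. Proof: restart at a time
`s > 0` with `u(s) ∈ H¹` from which the energy inequality holds
(`IsGlobalLerayHopf.exists_isGlobalLerayHopf_translate`), apply the `H¹` form to `u(· + s)`,
and use that neither mean sees the translation (`longTimeAvgSup_comp_add_right`,
`IsGlobalLerayHopf.meanEnergy_translate`). [cite: TranShepherd2002, §4 (constraint)] -/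
theorem singleShell_meanEnstrophy_le (hν : 0 < ν) (hg : IsSmooth g) (hgd : IsDivFree g)
    (hg0 : HasZeroMean g) {m : ℝ} (hm : 0 < m)
    (hshell : ∀ k : Fin 2 → ℤ, freqNormSq k ≠ m → mFourierCoeff (EuclideanSpace.complexify ∘ g) k = 0)
    (hu : IsGlobalLerayHopf ν (fun _ => g) u₀ u) :
    longTimeAvgSup (fun t => (eGradNormSq (u t)).toReal) ≤ 4 * Real.pi ^ 2 * m * meanEnergy u := by
  obtain ⟨s, hs, hGs, hw⟩ := hu.exists_isGlobalLerayHopf_translate hg hν.le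
  have h := singleShell_meanEnstrophy_le_of_H1 hν hg hgd hg0 hm hshell (hu.memLp_two hs.le) hGs.ne
    hw.isWeaklyDivFree_datum hw
  rw [hu.meanEnergy_translate hs.le] at h
  have hZ : longTimeAvgSup (fun t => (eGradNormSq (u (t + s))).toReal) =
      longTimeAvgSup (fun t => (eGradNormSq (u t)).toReal) :=
    longTimeAvgSup_comp_add_right (φ := fun t => (eGradNormSq (u t)).toReal)
      (fun _ => ENNReal.toReal_nonneg) hs.le
      (fun a b ha hab => intervalIntegrable_of_forall_integrableOn_Ioc
        (fun T hT => (hu.integrableOn_toReal_eGradNormSq hT).1) ha hab)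
  rwa [hZ] at h

/-- **No forcing, no mean enstrophy** (the degenerate shells `m ≤ 0`): for `ν > 0` and EVERY
global Leray–Hopf solution of the UNFORCED 2-D Navier–Stokes equations (any datum),
`⟨‖∇u‖₂²⟩ ≤ 0` — the energy inequality gives `ν∫₀ᵀ‖∇u‖² ≤ ½‖u₀‖²` uniformly in `T`
(`IsGlobalLerayHopf.toReal_lintegral_eGradNormSq_le_of_hasZeroMean` with zero force). [folklore] -/
theorem meanEnstrophy_nonpos_of_force_zero {d : Type*} [Fintype d] [DecidableEq d] (hν : 0 < ν)
    {v₀ : UnitAddTorus d → EuclideanSpace ℝ d} {v : ℝ → UnitAddTorus d → EuclideanSpace ℝ d}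
    (hv : IsGlobalLerayHopf ν (fun _ => (0 : UnitAddTorus d → EuclideanSpace ℝ d)) v₀ v) :
    longTimeAvgSup (fun t => (eGradNormSq (v t)).toReal) ≤ 0 := by
  have hF : MemLp (0 : UnitAddTorus d → EuclideanSpace ℝ d) 2 volume := MemLp.zero
  have hF0 : HasZeroMean (0 : UnitAddTorus d → EuclideanSpace ℝ d) := by
    show ∫ x, (0 : UnitAddTorus d → EuclideanSpace ℝ d) x = 0
    simp
  have hb : ∀ T, 0 < T → ∫ t in Ioc 0 T, (eGradNormSq (v t)).toReal ≤
      0 * (∫ t in Ioc 0 T, ∫ x, ‖v t x‖ ^ 2) + 2 * kineticEnergy v₀ / ν := by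
    intro T hT
    have h := hv.toReal_lintegral_eGradNormSq_le_of_hasZeroMean hν hF hF0 hT.le
    rw [← (hv.integrableOn_toReal_eGradNormSq hT).2] at h
    simp only [Pi.zero_apply, norm_zero, ne_eq, OfNat.ofNat_ne_zero, not_false_eq_true, zero_pow,
      integral_zero, zero_div, zero_mul, add_zero] at h
    rw [zero_mul, zero_add, le_div_iff₀ hν]
    linarith
  have h := longTimeAvgSup_le_mul_of_setIntegral_le le_rfl (fun _ => ENNReal.toReal_nonneg)
    (fun _ => integral_nonneg fun _ => sq_nonneg _) (hv.isBoundedUnder_timeMean_energy hν hF hF0) hb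
  rwa [zero_mul] at h

/-- **The mean dynamical constraint, all shells, all data.** On `𝕋²`, for `ν > 0`, a smooth
divergence-free mean-zero steady force `g` whose Fourier coefficients live on ONE shell
`|k|² = m` (`m ∈ ℝ` arbitrary: for `m ≤ 0` such a force vanishes), and EVERY global Leray–Hopf
solution `u` (any `L²` datum, any momentum): `⟨‖∇u‖₂²⟩ ≤ 4π² max(m,0) · ⟨‖u‖₂²⟩` — the planar
flow stays `ν`-uniformly in `H¹` in time mean at bounded mean energy (Tran–Shepherd 2002, §4;
Alexakis–Doering 2006, §4, `ε ≤ νk_f²U²`). [cite: TranShepherd2002, §4 (constraint)] -/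
theorem singleShell_meanEnstrophy_le_max (hν : 0 < ν) (hg : IsSmooth g) (hgd : IsDivFree g)
    (hg0 : HasZeroMean g) {m : ℝ}
    (hshell : ∀ k : Fin 2 → ℤ, freqNormSq k ≠ m → mFourierCoeff (EuclideanSpace.complexify ∘ g) k = 0)
    (hu : IsGlobalLerayHopf ν (fun _ => g) u₀ u) :
    longTimeAvgSup (fun t => (eGradNormSq (u t)).toReal) ≤
      4 * Real.pi ^ 2 * max m 0 * meanEnergy u := by
  rcases le_or_gt m 0 with hm | hm
  · have hg' : g = 0 := eq_zero_of_singleShell_of_nonpos hg hg0 hm hshell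
    subst hg'
    rw [max_eq_right hm, mul_zero, zero_mul]
    exact meanEnstrophy_nonpos_of_force_zero hν hu
  · rw [max_eq_left hm.le]
    exact singleShell_meanEnstrophy_le hν hg hgd hg0 hm hshell hu

end Mean

end Literature.Barriers.AnomalousDissipation

end
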